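import Literature.AlgebraicGeometry.Motives.FiniteQuotientQuasiProjective
import Literature.AlgebraicGeometry.Motives.NormMapInvariantMorphism
import Literature.AlgebraicGeometry.HodgeTheory.QuasiProjectiveOfFinite
import Mathlib.AlgebraicGeometry.Morphisms.Immersion
import HarnessLib

/-!
# The quotient of a (quasi-)projective `k`-scheme by a finite group is (quasi-)projective
# (Mumford, *Abelian Varieties* §7, Theorem p. 66 and Remark p. 69; SGA 1 V Prop. 1.8)

Topic `AlgebraicGeometry/Motives`; namespace `Literature.AlgebraicGeometry.Motives`. THEOREMS ONLY (no definition, no named fact,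
no instance, no `sorry`).

Let `k` be a field, `X` a `k`-scheme with an action `ρ` of a finite group `G` by `k`-automorphisms, and `X/G` the tree's
quotient (`Motives.finiteQuotient ρ`, `Motives/FiniteQuotient`, glued from the spectra of invariants over the `G`-stable affine
opens — Mumford's construction). Mumford, AV §7, Remark p. 69: «if `X` is quasi-projective (resp. projective) then so is `X/G`»;
Harris, Lecture 10; SGA 1 V Prop. 1.8. The tree so far only CARRIED the projectivity of `X/G` as a hypothesis
(`(hY : IsProjectiveOver (finiteQuotient ρ))` in `Motives/FiniteQuotient` §Transfer, e.g. `transfer_mk_of_isProjectiveOver`);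
this file PROVES it.

Proof (the printed one — norms of sections are invariant sections —, in the chart currency of the tree): let
`r : X ↪ ℙⁿ_k` be an immersion (`X` quasi-projective). For `x ∈ X`, graded prime avoidance gives a form `F_x` of positive
degree with the whole ORBIT `G·x ⊆ X_{F_x} := r⁻¹D₊(F_x)` and `X_{F_x}` AFFINE (`exists_form_finset_isAffineOpen_preimage`,
★ `GradedPrimeAvoidance.exists_form_basicOpen` on the open `r.coborderRange` in which `r(X)` is closed); then
`O_x := ⋂_g g⁻¹(X_{F_x}) ∋ x` is a `G`-stable affine open; finitely many `x` suffice and the forms may be taken of one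
degree `m` (`exists_forms_orbits`). The NORM MAP `N : X → ℙᴸ_k`, `z ↦ [… : ∏_g F_α(r(g z)) : …]` (★ `Motives.normMap` of
`Motives/NormMapInvariantMorphism` for the family `g ≫ r`, `g ∈ G`) is `G`-invariant (★ `comp_normMap_eq`: `h` permutes the
family by `g ↦ g h`) with `N⁻¹D₊(y_α) = O_α` (★ `normMap_left_preimage_basicOpen`), so it descends to `N̄ : X/G → ℙᴸ_k`
(★ `finiteQuotient.desc`), and `N̄⁻¹D₊(y_α)` is the chart `O_α/G ⊆ X/G` (★ `preimage_opensRange_gluedι`, `π` surjective), an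
AFFINE open (the spectrum of the invariants, ★ `SubringDatum.isAffineHom_fromSpec`): `N̄` is an AFFINE morphism to `ℙᴸ_k`
(`exists_isAffineHom_finiteQuotient_projectiveSpace`). Hence `X/G` is quasi-projective (★
`isQuasiProjectiveOver_of_isAffineHom_projectiveSpace`, `Motives/QuasiProjectiveOfGeneratingSections`; `X/G` is of finite type,
★ `locallyOfFiniteType_finiteQuotient_hom`) and projective when `X` is (★ `isProjectiveOver_of_isAffineHom`; `X/G` is proper,
★ `isProper_finiteQuotient_hom`) — Görtz–Wedhorn I Thm. 13.84: `N̄^*𝒪(1)` is ample.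

* `exists_form_finset_isAffineOpen_preimage` — finitely many points of a scheme immersed in `Proj 𝒜` lie in an AFFINE
  `r⁻¹D₊(F)`;
* `exists_forms_orbits` — forms `F : Fin N → 𝒜_m` with `r⁻¹D₊(F_α)` affine and `X = ⋃_α ⋂_g g⁻¹ r⁻¹ D₊(F_α)`;
* `exists_isAffineHom_finiteQuotient_projectiveSpace` — an affine `k`-morphism `X/G → ℙᴸ_k` (`X` quasi-projective, non-empty);
* **`isQuasiProjectiveOver_finiteQuotient`**, **`isProjectiveOver_finiteQuotient`** (the instance `[IsSeparated X.hom]`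
  needed to SPELL `finiteQuotient ρ` is a binder, as in `Motives/FiniteQuotient`; it follows from quasi-projectivity,
  ★ `IsQuasiProjectiveOver.isVarietyPair_ofScheme`).

Cell `hodgecm-mathlib`, count-neutral capital (HC_CM is proved only modulo the 7 printed citations until rung 0 closes; this file
discharges none of them).

## References
* D. Mumford, *Abelian Varieties* (1970), §7, Theorem p. 66 and Remark p. 69. [MumfordAV1970]
* A. Grothendieck, *SGA 1*, Exp. V, Prop. 1.8. [SGA1]
* J. Harris, *Algebraic Geometry: A First Course* (1992), Lecture 10 (quotients of projective varieties by finite groups). [Harris1992]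
* U. Görtz, T. Wedhorn, *Algebraic Geometry I*, 2nd ed. (2020), Thm. 13.84 (p. 408), Prop. 13.49 (p. 393). [GortzWedhorn2020]
-/

universe u

open CategoryTheory AlgebraicGeometry Limits HomogeneousLocalization TopologicalSpace Opposite
open Literature.AlgebraicGeometry.Motives.Segre
open Literature.AlgebraicGeometry.RelativeSpec
open Literature.AlgebraicGeometry.HodgeTheory (IsQuasiProjectiveOver)

noncomputable section

namespace Literature.AlgebraicGeometry.Motives

/-! ### Forms through finitely many points with affine non-vanishing locus -/

section Forms

variable {A : Type u} {σ : Type*} [CommRing A] [SetLike σ A] [AddSubgroupClass σ A]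
  (𝒜 : ℕ → σ) [GradedRing 𝒜] {Y : Scheme.{u}} (r : Y ⟶ Proj 𝒜) [IsImmersion r]

/-- **Finitely many points of a scheme immersed in `Proj 𝒜` lie in an AFFINE open `r⁻¹ D₊(F)`**, `F` a form of positive
degree: graded prime avoidance on the open `Ω = r.coborderRange` of `Proj 𝒜` in which `r(Y)` is closed (★
`GradedPrimeAvoidance.exists_form_basicOpen`) gives `F` with `r(T) ⊆ D₊(F) ⊆ Ω`; `D₊(F)` is affine, hence so is its preimage
under the closed immersion `Y ↪ Ω` (Mumford AV §7 Remark p. 69: «any finite set of points of a quasi-projective variety is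
contained in an affine open»; Görtz–Wedhorn I Prop. 13.49). [cite: MumfordAV1970, §7 Remark p. 69]
[cite: GortzWedhorn2020, Prop. 13.49 (p. 393)] -/
theorem exists_form_finset_isAffineOpen_preimage (T : Finset Y) :
    ∃ (m : ℕ) (F : A), 0 < m ∧ F ∈ 𝒜 m ∧ (∀ t ∈ T, t ∈ r ⁻¹ᵁ Proj.basicOpen 𝒜 F) ∧
      IsAffineOpen (r ⁻¹ᵁ Proj.basicOpen 𝒜 F) := by
  classical
  have hΩ : ∀ t ∈ T.image r, t ∈ r.coborderRange := by
    intro t ht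
    obtain ⟨y, -, rfl⟩ := Finset.mem_image.mp ht
    exact subset_coborder ⟨y, rfl⟩
  obtain ⟨m, F, hm, hF, hT, hle⟩ := GradedPrimeAvoidance.exists_form_basicOpen 𝒜
    (𝟙 (Proj 𝒜)) Function.injective_id IsClosedMap.id (T.image r) r.coborderRange hΩ
  have hle' : Proj.basicOpen 𝒜 F ≤ r.coborderRange := by simpa using hle
  refine ⟨m, F, hm, hF, fun t ht ↦ ?_, ?_⟩
  · have h := hT (r t) (Finset.mem_image_of_mem _ ht)
    simpa using h
  · have hD : IsAffineOpen (Proj.basicOpen 𝒜 F) := Proj.isAffineOpen_basicOpen 𝒜 F hF hm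
    have hV : IsAffineOpen (r.coborderRange.ι ⁻¹ᵁ Proj.basicOpen 𝒜 F) := by
      rw [← r.coborderRange.ι.isAffineOpen_iff_of_isOpenImmersion,
        Scheme.Hom.image_preimage_eq_opensRange_inf, Scheme.Opens.opensRange_ι,
        inf_eq_right.mpr hle']
      exact hD
    have hpre : r.liftCoborder ⁻¹ᵁ (r.coborderRange.ι ⁻¹ᵁ Proj.basicOpen 𝒜 F) =
        r ⁻¹ᵁ Proj.basicOpen 𝒜 F := by
      rw [← Scheme.Hom.comp_preimage, Scheme.Hom.liftCoborder_ι]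
    rw [← hpre]
    exact hV.preimage r.liftCoborder

/-- **Forms adapted to the orbits of a finite group**: for a finite group `G` acting on the quasi-compact scheme `Y`
immersed in `Proj 𝒜` by `r`, there are finitely many forms `F_α` of ONE positive degree `m` such that every `r⁻¹D₊(F_α)` is
affine and the `G`-stable opens `⋂_g g⁻¹ r⁻¹ D₊(F_α)` cover `Y` (apply `exists_form_finset_isAffineOpen_preimage` to each
orbit, extract a finite subcover, raise to a common degree). Mumford AV §7, proof of the Theorem p. 66: «the orbit of any
point is contained in an affine open». [cite: MumfordAV1970, §7 Thm. p. 66 (proof) and Remark p. 69] -/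
theorem exists_forms_orbits {G : Type} [Group G] [Finite G] (act : G → (Y ⟶ Y)) [CompactSpace Y] :
    ∃ (N m : ℕ) (F : Fin N → A), 0 < m ∧ (∀ α, F α ∈ 𝒜 m) ∧ (∀ α, IsAffineOpen (r ⁻¹ᵁ Proj.basicOpen 𝒜 (F α))) ∧
      ⨆ α, (⨅ g, (act g ≫ r) ⁻¹ᵁ Proj.basicOpen 𝒜 (F α)) = ⊤ := by
  classical
  haveI := Fintype.ofFinite G
  -- a form for each orbit
  choose m F hm hF hT haff using fun y : Y ↦
    exists_form_finset_isAffineOpen_preimage 𝒜 r (Finset.univ.image fun g : G ↦ act g y)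
  -- the stable opens `O y = ⋂_g g⁻¹ r⁻¹ D₊(F y)` cover
  let O : Y → Y.Opens := fun y ↦ ⨅ g, (act g ≫ r) ⁻¹ᵁ Proj.basicOpen 𝒜 (F y)
  have hO : ∀ y, y ∈ O y := by
    intro y
    change y ∈ ((⨅ g, (act g ≫ r) ⁻¹ᵁ Proj.basicOpen 𝒜 (F y) : Y.Opens) : Set Y)
    rw [Opens.coe_iInf]
    exact Set.mem_iInter.mpr fun g ↦ hT y (act g y) (Finset.mem_image_of_mem _ (Finset.mem_univ g))
  obtain ⟨T, hTcov⟩ := isCompact_univ.elim_finite_subcover (fun y : Y ↦ (O y : Set Y)) (fun y ↦ (O y).2)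
    (fun y _ ↦ Set.mem_iUnion.mpr ⟨y, hO y⟩)
  -- common degree
  set d : ℕ := ∏ y ∈ T, m y with hd
  have hd0 : 0 < d := Finset.prod_pos fun y _ ↦ hm y
  have hdvd : ∀ y ∈ T, m y ∣ d := fun y hyT ↦ Finset.dvd_prod_of_mem m hyT
  set e := T.equivFin with he
  have hpow : ∀ i : Fin T.card, Proj.basicOpen 𝒜 (F (e.symm i) ^ (d / m (e.symm i))) =
      Proj.basicOpen 𝒜 (F (e.symm i)) := fun i ↦
    Proj.basicOpen_pow 𝒜 _ _ (Nat.div_pos (Nat.le_of_dvd hd0 (hdvd _ (e.symm i).2)) (hm _))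
  refine ⟨T.card, d, fun i ↦ F (e.symm i) ^ (d / m (e.symm i)), hd0, fun i ↦ ?_, fun i ↦ ?_, ?_⟩
  · have h := SetLike.pow_mem_graded (d / m (e.symm i).1) (hF (e.symm i))
    rwa [smul_eq_mul, Nat.div_mul_cancel (hdvd _ (e.symm i).2)] at h
  · rw [hpow]
    exact haff _
  · rw [← top_le_iff]
    intro y _
    have hyU : y ∈ ⋃ z ∈ T, (O z : Set Y) := hTcov (Set.mem_univ y)
    obtain ⟨z, hzT, hyz⟩ := Set.mem_iUnion₂.mp hyU
    refine Opens.mem_iSup.mpr ⟨e ⟨z, hzT⟩, ?_⟩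
    simp_rw [hpow, Equiv.symm_apply_apply]
    exact hyz

end Forms

/-! ### An affine morphism `X/G → ℙᴸ_k` -/

section Quotient

variable {k : Type u} [Field k] {X : SchemeOver k} {G : Type} [Group G] [Finite G] (ρ : ActionOver X.hom G)

/-- **An AFFINE `k`-morphism `X/G → ℙᴸ_k` for a non-empty quasi-projective `X`** — the descent of the `G`-invariant norm
map `N : X → ℙᴸ_k` (★ `Motives.normMap` for the translates `g ≫ r` of an immersion `r : X ↪ ℙⁿ_k` and forms adapted to
the orbits): `N⁻¹D₊(y_α)` is a `G`-stable AFFINE open `O_α` and `N̄⁻¹D₊(y_α) = O_α/G` is affine (Mumford AV §7 proof of the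
Theorem p. 66 and Remark p. 69; Görtz–Wedhorn I Thm. 13.84). [cite: MumfordAV1970, §7 Thm. p. 66 (proof) and Remark p. 69]
[cite: GortzWedhorn2020, Thm. 13.84 (p. 408)] -/
theorem exists_isAffineHom_finiteQuotient_projectiveSpace [IsSeparated X.hom] [Nonempty X.left]
    (hcov : ∀ x : X.left, ∃ O : ρ.StableAffineOpens, x ∈ O.1) (hX : IsQuasiProjectiveOver X) :
    ∃ (L : ℕ) (Nbar : finiteQuotient ρ ⟶ projectiveSpace L k), IsAffineHom Nbar.left := by
  classical
  haveI := Fintype.ofFinite G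
  have hqc : QuasiCompact X.hom := hX.isVarietyPair_ofScheme.quasiCompact
  obtain ⟨P, j, ⟨n, ι, hι⟩, hj⟩ := hX
  letI := MvPolynomial.gradedAlgebra (σ := Fin (n + 1)) (R := k)
  -- the immersion `r = ι ∘ j : X ↪ ℙⁿ_k`, at the unfolded types
  set ιl : P.left ⟶ Proj (MvPolynomial.homogeneousSubmodule (Fin (n + 1)) k) := ι.left with hιl
  haveI : IsClosedImmersion ιl := hι
  set jl : X.left ⟶ P.left := j.left with hjl
  haveI : IsOpenImmersion jl := hj
  set r : X.left ⟶ Proj (MvPolynomial.homogeneousSubmodule (Fin (n + 1)) k) := jl ≫ ιl with hr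
  haveI : IsImmersion r := inferInstance
  haveI : CompactSpace X.left := (quasiCompact_iff_compactSpace X.hom).mp hqc
  haveI : X.left.IsSeparated := ⟨by rw [← terminal.comp_from X.hom]; infer_instance⟩
  -- forms adapted to the orbits, of one degree
  obtain ⟨N, m, F, hm, hF, haff, hcovN⟩ :=
    exists_forms_orbits (MvPolynomial.homogeneousSubmodule (Fin (n + 1)) k) r (fun g ↦ (ρ.aut g).hom)
  -- `X` is non-empty, so there is at least one form
  obtain ⟨L, rfl⟩ : ∃ L, N = L + 1 := by
    obtain ⟨x⟩ := ‹Nonempty X.left›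
    have hx : x ∈ (⊤ : X.left.Opens) := trivial
    rw [← hcovN, Opens.mem_iSup] at hx
    obtain ⟨α, -⟩ := hx
    exact ⟨N - 1, (Nat.succ_pred_eq_of_pos (Fin.pos α)).symm⟩
  letI := MvPolynomial.gradedAlgebra (σ := Fin (L + 1)) (R := k)
  -- the norm map `N : X → ℙᴸ_k` of the family `g ≫ r` and its invariance
  let rG : G → (X.left ⟶ Proj (MvPolynomial.homogeneousSubmodule (Fin (n + 1)) k)) := fun g ↦ (ρ.aut g).hom ≫ r
  let Nm : X ⟶ projectiveSpace L k := normMap rG F hF hm hcovN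
  have hinv : ∀ h : G, (ρ.overIso h).hom ≫ Nm = Nm := fun h ↦
    comp_normMap_eq rG F hF hm hcovN (ρ.overIso h).hom (Equiv.mulRight h) fun g ↦ by
      change (ρ.aut h).hom ≫ (ρ.aut g).hom ≫ r = (ρ.aut (g * h)).hom ≫ r
      rw [map_mul, Aut.Aut_mul_def, Iso.trans_hom, Category.assoc]
  -- descend it to `X/G`
  haveI : IsProper (projectiveSpace L k).hom := isProper_projectiveSpace L k
  haveI : (projectiveSpace L k).left.IsSeparated :=
    ⟨by rw [← terminal.comp_from (projectiveSpace L k).hom]; infer_instance⟩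
  let Nbar : finiteQuotient ρ ⟶ projectiveSpace L k := finiteQuotient.desc ρ hcov Nm hinv
  have hfac : finiteQuotient.mk ρ hcov ≫ Nbar = Nm := finiteQuotient.mk_desc ρ hcov Nm hinv
  refine ⟨L, Nbar, ?_⟩
  -- affineness, chart by chart over the standard cover of `ℙᴸ_k`
  refine (HasAffineProperty.iff_of_iSup_eq_top (P := @IsAffineHom) (f := Nbar.left)
    (fun α : Fin (L + 1) ↦ ⟨Proj.basicOpen (grading (Fin (L + 1)) k) (MvPolynomial.X α),
      Proj.isAffineOpen_basicOpen _ _ (X_mem k α) zero_lt_one⟩)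
    (Proj.iSup_basicOpen_eq_top (grading (Fin (L + 1)) k) (fun α : Fin (L + 1) ↦ MvPolynomial.X α)
      (irrelevant_le_span_X (Fin (L + 1)) k))).2 fun α ↦ ?_
  change IsAffineOpen (Nbar.left ⁻¹ᵁ Proj.basicOpen (grading (Fin (L + 1)) k) (MvPolynomial.X α))
  -- the chart `O_α = ⋂_g g⁻¹ r⁻¹ D₊(F_α)` of the norm map: `G`-stable, affine
  set Oα : X.left.Opens := ⨅ g, rG g ⁻¹ᵁ Proj.basicOpen (MvPolynomial.homogeneousSubmodule (Fin (n + 1)) k) (F α)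
    with hOα
  have hOaff : IsAffineOpen Oα := IsAffineOpen.iInf fun g ↦ by
    change IsAffineOpen (((ρ.aut g).hom ≫ r) ⁻¹ᵁ Proj.basicOpen _ (F α))
    rw [Scheme.Hom.comp_preimage]
    exact (haff α).preimage (ρ.aut g).hom
  have hOst : ∀ h : G, (ρ.aut h).hom ⁻¹ᵁ Oα = Oα := by
    intro h
    rw [hOα, preimage_iInf]
    simp_rw [← Scheme.Hom.comp_preimage]
    have hg : ∀ g, (ρ.aut h).hom ≫ rG g = rG (g * h) := fun g ↦ by
      change (ρ.aut h).hom ≫ (ρ.aut g).hom ≫ r = (ρ.aut (g * h)).hom ≫ r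
      rw [map_mul, Aut.Aut_mul_def, Iso.trans_hom, Category.assoc]
    simp_rw [hg]
    exact Equiv.iInf_comp (g := fun g ↦ rG g ⁻¹ᵁ Proj.basicOpen _ (F α)) (Equiv.mulRight h)
  haveI : IsAffine (Oα : Scheme.{u}) := hOaff
  haveI : IsAffine ((Functor.fromPUnit (Spec (.of k))).obj X.right) := inferInstanceAs (IsAffine (Spec (.of k)))
  let O : ρ.StableAffineOpens := ⟨Oα, hOst, inferInstance⟩
  -- `π⁻¹(N̄⁻¹ D₊(y_α)) = N⁻¹ D₊(y_α) = O_α = π⁻¹(O_α/G)`, and `π` is surjective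
  have hpre : (finiteQuotient.mk ρ hcov).left ⁻¹ᵁ (Nbar.left ⁻¹ᵁ
      Proj.basicOpen (grading (Fin (L + 1)) k) (MvPolynomial.X α)) = Oα := by
    rw [← Scheme.Hom.comp_preimage, ← Over.comp_left, hfac]
    exact normMap_left_preimage_basicOpen rG F hF hm hcovN α
  have heq : Nbar.left ⁻¹ᵁ Proj.basicOpen (grading (Fin (L + 1)) k) (MvPolynomial.X α) = (ρ.gluedι O).opensRange := by
    have hsurj : Function.Surjective (finiteQuotient.mk ρ hcov).left := finiteQuotient.mk_left_surjective ρ hcov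
    apply Opens.ext
    apply (Set.preimage_injective.mpr hsurj)
    have h1 := congrArg (fun U : X.left.Opens ↦ (U : Set X.left)) hpre
    have h2 := congrArg (fun U : X.left.Opens ↦ (U : Set X.left)) (ρ.preimage_opensRange_gluedι hcov O)
    exact h1.trans h2.symm
  rw [heq]
  -- the chart `O_α/G` is affine: the spectrum of the invariants
  haveI : IsAffine (ρ.pieceQuot O) :=
    isAffine_of_isAffineHom (ρ.restrict O.1 O.2.1).quotientToBase
  exact isAffineOpen_opensRange (ρ.gluedι O)

/-- **THE QUOTIENT OF A QUASI-PROJECTIVE `k`-SCHEME BY A FINITE GROUP IS QUASI-PROJECTIVE** (Mumford AV §7 Remark p. 69; SGA 1 V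
Prop. 1.8): `X/G` admits an affine `k`-morphism to `ℙᴸ_k` (`exists_isAffineHom_finiteQuotient_projectiveSpace`) and is of finite
type (★ `locallyOfFiniteType_finiteQuotient_hom`), hence is quasi-projective (★ `isQuasiProjectiveOver_of_isAffineHom_projectiveSpace`,
Görtz–Wedhorn I Thm. 13.84 with Summary 13.71 (1)). [cite: MumfordAV1970, §7 Thm. p. 66 and Remark p. 69]
[cite: SGA1, Exp. V, Prop. 1.8] -/
theorem isQuasiProjectiveOver_finiteQuotient [IsSeparated X.hom] (hX : IsQuasiProjectiveOver X) :
    IsQuasiProjectiveOver (finiteQuotient ρ) := by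
  haveI : LocallyOfFiniteType X.hom := hX.isVarietyPair_ofScheme.locallyOfFiniteType
  have hcov : ∀ x : X.left, ∃ O : ρ.StableAffineOpens, x ∈ O.1 :=
    ActionOver.forall_exists_stableAffineOpen_of_isQuasiProjectiveOver ρ hX
  haveI : LocallyOfFiniteType (finiteQuotient ρ).hom := locallyOfFiniteType_finiteQuotient_hom ρ
  cases isEmpty_or_nonempty X.left with
  | inl hX0 =>
    haveI : IsEmpty (finiteQuotient ρ).left :=
      ⟨fun y ↦ by
        obtain ⟨x, -⟩ := finiteQuotient.mk_left_surjective ρ hcov y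
        exact hX0.elim x⟩
    exact IsQuasiProjectiveOver.of_isProjectiveOver isProjectiveOver_of_isEmpty
  | inr hX1 =>
    obtain ⟨L, Nbar, hN⟩ := exists_isAffineHom_finiteQuotient_projectiveSpace ρ hcov hX
    haveI := hN
    exact isQuasiProjectiveOver_of_isAffineHom_projectiveSpace Nbar

/-- **THE QUOTIENT OF A PROJECTIVE `k`-SCHEME BY A FINITE GROUP IS PROJECTIVE** (Mumford AV §7 Remark p. 69; Harris Lecture 10;
SGA 1 V Prop. 1.8): `X/G` is proper (★ `isProper_finiteQuotient_hom`) with an affine — hence finite — `k`-morphism to `ℙᴸ_k`, so it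
is projective (★ `isProjectiveOver_of_isAffineHom`, Görtz–Wedhorn I Thm. 13.84 with Cor. 13.72). This discharges the hypothesis
`hY : IsProjectiveOver (finiteQuotient ρ)` of ★ `Motives/FiniteQuotient` §Transfer. [cite: MumfordAV1970, §7 Thm. p. 66 and Remark p. 69]
[cite: SGA1, Exp. V, Prop. 1.8] -/
theorem isProjectiveOver_finiteQuotient [IsSeparated X.hom] (hX : IsProjectiveOver X) :
    IsProjectiveOver (finiteQuotient ρ) := by
  have hXq : IsQuasiProjectiveOver X := IsQuasiProjectiveOver.of_isProjectiveOver hX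
  haveI : IsProper X.hom := hX.isProper
  have hcov : ∀ x : X.left, ∃ O : ρ.StableAffineOpens, x ∈ O.1 :=
    ActionOver.forall_exists_stableAffineOpen_of_isQuasiProjectiveOver ρ hXq
  haveI : IsProper (finiteQuotient ρ).hom := isProper_finiteQuotient_hom ρ hcov
  cases isEmpty_or_nonempty X.left with
  | inl hX0 =>
    haveI : IsEmpty (finiteQuotient ρ).left :=
      ⟨fun y ↦ by
        obtain ⟨x, -⟩ := finiteQuotient.mk_left_surjective ρ hcov y
        exact hX0.elim x⟩
    exact isProjectiveOver_of_isEmpty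
  | inr hX1 =>
    obtain ⟨L, Nbar, hN⟩ := exists_isAffineHom_finiteQuotient_projectiveSpace ρ hcov hXq
    haveI := hN
    exact isProjectiveOver_of_isAffineHom Nbar

end Quotient

end Literature.AlgebraicGeometry.Motives

end
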